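import Summits.QuantumFields.YangMills.Theorems.UnitScaleTiltFluctuationComparisonRegPrGlobalSlackKernelLegCfgFixedPoint
import Summits.QuantumFields.YangMills.Theorems.UnitScaleTiltFluctuationComparisonRegPrGlobalSlackKernelLegDisplayProfile
import HarnessLib

/-!
# `UnitScaleTiltFluctuationComparisonRegPrGlobalSlackKernelLegCfgFixedPointChi` — THE FIXED-POINT READING OF (R5) AT THE χ-RECORD'S CANONICAL DATUM AND IN THE DOOR DISPLAY
# (crux `FluctuationComparisonRegPrIntL`, stmt-QuantumFields-20520, skeleton v5kC, STUB 3⁗χ `stub_globalTwoRunSlackFamChi`; cell `pub/ym-inputs`, seat ym-inputs-p12 = INPUT-LIST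
# I-11 row `CfgDistCauchyΦ`; count-neutral helper, registry untouched)

Sibling of `…KernelLegCfgFixedPoint` (same seat): there, (R5) `CfgRefOwnΦ` / `CfgRefΦ` / the I-11 row `CfgDistCauchyΦ` are derived for a FIXED-POINT background from four
single-run displays — (F) «`B` solves run `K`'s equation `T (B) = B`», (C) «`T` is a legwise `(1+d)`-weighted `q`-contraction on the (44)-ball, ONE `q < 1` for every run»,
(S) the (44) rows for `B` and for the reference `BR`, (D) the defect row `‖T (BR) − BR‖ ≤ C₀(1+d)θ x² (L^{−(1+j)})^a` — [King1986] Prop. 3.9's replacement step (p.665 L9–14)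
typed for [Balaban1985Variational]'s successive-approximation minimiser instead of King's linear background.  This file instantiates it where the door reads it:

* §0 **`cfgRefOwnΦ_of_isFixedPt_weight`** — the ROBUST form of (R5)-from-a-fixed-point: the contraction (C) and the defect (D) are displayed in a legwise weighted currency with
  ANY positive weight family `w K k b Y W c` dominated by the (R5) budget shape `(1 + d(c))·θ(n)·x²·(L^{−(1+j)})^a` (print's successive approximations contract in CURRENT-lattice
  units, the (44) budget grows in CHART-level units — the weight is the supplier's choice, `…CfgFixedPoint`'s `1 + d` being one instance).
* §1 **`cfgRefΦ_chi_of_isFixedPt`**, **`cfgDistCauchyΦ_chi_of_isFixedPt`** — at the χ-datum `dataOfV3chi p (canonPolymerCore (toCore ∘ p))`, the canonical leg distance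
  `canonLegDist F`, the record's `𝔠.b₀` and a FREE profile `p₁` (the door display reads (R4)/(R5) at `(𝔠.b₀, p₁)`, `p₁ ≥ 𝔠.p₀ + 𝔠.r₀`); geometry (`locMatched_canonCore`,
  `canonLegDist_matched/_nonneg`) and window letters (`𝔠.b₀ > 0`, `γ ≤ (min γ₀ 1)² ≤ 1`, `1 < L`) discharged — no hypothesis left but (F), (C), (S), (D) (+ `RefCfgCoherent BR`
  for the two-run row).
* §2 **`k1aLegRowsDisplayChiAt_of_fixedPointDisplay`** — THE DOOR DISPLAY WITH (R5) REPLACED: if the six-row display `K1aLegRowsDisplayChiAt L 𝔠 a₀ a₁ a p₁` (★w1-20520 g2,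
  `…KernelLegDisplayProfile`) is displayed with its row (R5) `CfgRefOwnΦ … C_B` replaced by «(S′) `CfgDistOwnΦ … BR … C_s` ∧ ∃ T w, (W) ∧ (F) ∧ (C_w)_q ∧ (D_w)_{C₀}» (free weight; constants
  `q < 1`, `C₀ ≥ 0` quantified with the others, BEFORE the family), then `K1aLegRowsDisplayChiAt L 𝔠 a₀ a₁ a p₁` holds with `C_B := C₀/(1−q)`; hence, BY NAME, every door of record fed by
  the display (`globalSupRateTSlack_of_k1aLegRowsDisplayChiAt`, `regPrIntL_of_T8_recChi_k1aLegRowsDisplayChiAt_allL`, `YM3OfFiveInputsProfile.ym3TorusSU2_of_fiveInputs_displayAt`)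
  accepts the fixed-point display in place of (R5).  The display text is written INLINE (def-free seat); `T` is quantified AFTER the package `p` (it is run `K`'s equation, built
  from the package's step data), `Ψ`, `BR` before the (α) hypothesis as in the display of record.
HONEST FRAMING.  Bookkeeping over hypothesis schemas; a REDUCTION of what the v4 record / B0 must display for (R5), not a discharge ((C), (D) for Bałaban's minimiser are
located-UNPRINTED for the non-abelian d = 3 model; [King1986] §4 is the flat U(1) template); nothing of [Balaban1985UV3] / [Balaban1985Variational] / [King1986] is asserted;
registry untouched; no summit / rung / gap claim (YM₃ on T³ is rung R3, not the Clay problem).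

References: C. King, CMP 102 (1986) 649–677 [King1986] (Thm 3.4 (3.9) p.656, Prop. 3.6 (3.56) p.662, Prop. 3.9 (3.71)–(3.74) p.665, Prop. 3.10 (3.91) p.669); T. Bałaban,
CMP 102 (1985) 255–275 [Balaban1985UV3] ((25) p.262, (43)–(45) pp.266–267, (57) p.270); CMP 102 (1985) 277–309 [Balaban1985Variational] (Thm 1 (8) p.279); CMP 109 (1987)
249–301 [Balaban1987RG1] ((0.1) p.251).
-/

set_option autoImplicit false

noncomputable section

open scoped BigOperators
open Finset
open Literature.MathematicalPhysics.QuantumFieldTheory.Balaban1983to89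
open Literature.MathematicalPhysics.QuantumFieldTheory.Balaban1983to89.T3ContinuumYM3Torus
open Literature.MathematicalPhysics.QuantumFieldTheory.Balaban1983to89.T3UnitScaleTilt
open Literature.MathematicalPhysics.QuantumFieldTheory.Balaban1983to89.T3LevelShift
open Literature.MathematicalPhysics.QuantumFieldTheory.Balaban1983to89.T3AlphaInputsAC
open Literature.MathematicalPhysics.QuantumFieldTheory.Balaban1983to89.T3AlphaPolymerSocket
open Literature.MathematicalPhysics.QuantumFieldTheory.Balaban1983to89.T3AlphaInputsACTwoRun
open Literature.MathematicalPhysics.QuantumFieldTheory.Balaban1983to89.T3AlphaInputsACTwoRunLevel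
open Literature.MathematicalPhysics.QuantumFieldTheory.Balaban1985CMP102
open Literature.MathematicalPhysics.QuantumFieldTheory.Balaban1985CMP102.Setting
open Summit.QuantumFields.Balaban3D.Carriers
open Summit.QuantumFields.Balaban3D.Proofs.Primitives
open Summit.QuantumFields.Balaban3D.Proofs.GroupModelLieC (lieC)
open Summit.QuantumFields.YangMills.Theorems
open Summit.QuantumFields.YangMills.Theorems.GlobalSlackKernelMatching
open Summit.QuantumFields.YangMills.Theorems.GlobalSlackCanonicalPolymers

namespace Summit.QuantumFields.YangMills.Theorems.GlobalSlackKernelLeg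

/-! ## §0 (R5) for a fixed-point background with a SUPPLIER-CHOSEN weight -/

section FreeWeight

variable {𝕍 : Type} [NormedAddCommGroup 𝕍] [NormedSpace ℂ 𝕍] {F : T3Family} {γ : ℝ}

omit [NormedSpace ℂ 𝕍] in
/-- **(R5) FOR A FIXED-POINT BACKGROUND, FREE WEIGHT** (the robust form of `cfgRefOwnΦ_of_isFixedPt`): the contraction (C) and the defect (D) are displayed in a
legwise weighted currency with ANY positive weight family `w K k b Y W c` dominated by the row's shape, (W) `w … c ≤ (1 + d(c))·θ(n)·x²·(L^{−(1+j)})^a` — print's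
successive approximations contract in CURRENT-lattice units while the (44) budget grows in chart-level units, so the weight is the supplier's to choose; (F) `T (B) = B` and
(S) the (44)-ball membership of `B`, `BR` as before; (C_w) `(∀ c, ‖x c − y c‖ ≤ M·w c) → ∀ c, ‖T x c − T y c‖ ≤ q·M·w c` on the ball, ONE `q < 1`; (D_w) `‖T (BR) c − BR c‖ ≤ C₀·w c`.
Then `CfgRefOwnΦ D B BR dist b₀ p₀ a (C₀/(1−q))`. [cite: King1986, Prop. 3.9 (3.73)-(3.74) p.665; Balaban1985UV3, (44)-(45) p.267; Balaban1985Variational, Thm 1 (8) p.279] -/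
theorem cfgRefOwnΦ_of_isFixedPt_weight {D : AlphaDataT3 F γ} {B BR : CfgFam 𝕍 F} {dist : LegDist F} {b₀ p₀ a C_s q C₀ : ℝ}
    (T : (K k b : ℕ) → Set (Site (F.P K) 0) → GaugeField (F.P K) k (Matrix.specialUnitaryGroup (Fin 2) ℂ) → (PBond (F.P K) b → 𝕍) → (PBond (F.P K) b → 𝕍))
    (w : (K k b : ℕ) → Set (Site (F.P K) 0) → GaugeField (F.P K) k (Matrix.specialUnitaryGroup (Fin 2) ℂ) → PBond (F.P K) b → ℝ)
    (hq1 : q < 1) (hC₀ : 0 ≤ C₀)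
    (hB : CfgDistOwnΦ D B dist b₀ p₀ C_s) (hBR : CfgDistOwnΦ D BR dist b₀ p₀ C_s)
    (hw : ∀ (K n : ℕ) (h : n ≤ K), ∀ j : ℕ, j < K - n →
      ∀ V : GaugeField (F.P n) 0 (Matrix.specialUnitaryGroup (Fin 2) ℂ), PlaqSmall (θBal F.L γ b₀ p₀ n) V →
        ∀ Y ∈ D.Loc K (K - n) (D.triv K (K - n)) (1 + j), ∀ c : PBond (F.P K) j,
          0 < w K (K - n) j Y (fieldShift (F.sitesPerDir_eq (m := F.m) (K := K) (j := K - n) (m' := F.m) (K' := n) (j' := 0) (by omega)) V) c ∧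
          w K (K - n) j Y (fieldShift (F.sitesPerDir_eq (m := F.m) (K := K) (j := K - n) (m' := F.m) (K' := n) (j' := 0) (by omega)) V) c ≤ (1 + dist K j Y c) * θBal F.L γ b₀ p₀ n * (((F.L : ℝ) ^ (K - n - 1 - j))⁻¹) ^ 2 * (((F.L : ℝ) ^ (1 + j))⁻¹) ^ a)
    (hfix : ∀ (K n : ℕ) (h : n ≤ K), ∀ j : ℕ, j < K - n →
      ∀ V : GaugeField (F.P n) 0 (Matrix.specialUnitaryGroup (Fin 2) ℂ), PlaqSmall (θBal F.L γ b₀ p₀ n) V →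
        ∀ Y ∈ D.Loc K (K - n) (D.triv K (K - n)) (1 + j),
          T K (K - n) j Y (fieldShift (F.sitesPerDir_eq (m := F.m) (K := K) (j := K - n) (m' := F.m) (K' := n) (j' := 0) (by omega)) V) (B K (K - n) j Y (fieldShift (F.sitesPerDir_eq (m := F.m) (K := K) (j := K - n) (m' := F.m) (K' := n) (j' := 0) (by omega)) V)) = B K (K - n) j Y (fieldShift (F.sitesPerDir_eq (m := F.m) (K := K) (j := K - n) (m' := F.m) (K' := n) (j' := 0) (by omega)) V))
    (hlip : ∀ (K n : ℕ) (h : n ≤ K), ∀ j : ℕ, j < K - n →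
      ∀ V : GaugeField (F.P n) 0 (Matrix.specialUnitaryGroup (Fin 2) ℂ), PlaqSmall (θBal F.L γ b₀ p₀ n) V →
        ∀ Y ∈ D.Loc K (K - n) (D.triv K (K - n)) (1 + j), ∀ x y : PBond (F.P K) j → 𝕍,
          (∀ c, ‖x c‖ ≤ C_s * (1 + dist K j Y c) * θBal F.L γ b₀ p₀ n * (((F.L : ℝ) ^ (K - n - 1 - j))⁻¹) ^ 2) →
          (∀ c, ‖y c‖ ≤ C_s * (1 + dist K j Y c) * θBal F.L γ b₀ p₀ n * (((F.L : ℝ) ^ (K - n - 1 - j))⁻¹) ^ 2) →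
            ∀ M : ℝ, 0 ≤ M → (∀ c, ‖x c - y c‖ ≤ M * w K (K - n) j Y (fieldShift (F.sitesPerDir_eq (m := F.m) (K := K) (j := K - n) (m' := F.m) (K' := n) (j' := 0) (by omega)) V) c) →
              ∀ c, ‖T K (K - n) j Y (fieldShift (F.sitesPerDir_eq (m := F.m) (K := K) (j := K - n) (m' := F.m) (K' := n) (j' := 0) (by omega)) V) x c - T K (K - n) j Y (fieldShift (F.sitesPerDir_eq (m := F.m) (K := K) (j := K - n) (m' := F.m) (K' := n) (j' := 0) (by omega)) V) y c‖ ≤ q * M * w K (K - n) j Y (fieldShift (F.sitesPerDir_eq (m := F.m) (K := K) (j := K - n) (m' := F.m) (K' := n) (j' := 0) (by omega)) V) c)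
    (hdef : ∀ (K n : ℕ) (h : n ≤ K), ∀ j : ℕ, j < K - n →
      ∀ V : GaugeField (F.P n) 0 (Matrix.specialUnitaryGroup (Fin 2) ℂ), PlaqSmall (θBal F.L γ b₀ p₀ n) V →
        ∀ Y ∈ D.Loc K (K - n) (D.triv K (K - n)) (1 + j), ∀ c : PBond (F.P K) j,
          ‖T K (K - n) j Y (fieldShift (F.sitesPerDir_eq (m := F.m) (K := K) (j := K - n) (m' := F.m) (K' := n) (j' := 0) (by omega)) V) (BR K (K - n) j Y (fieldShift (F.sitesPerDir_eq (m := F.m) (K := K) (j := K - n) (m' := F.m) (K' := n) (j' := 0) (by omega)) V)) c - BR K (K - n) j Y (fieldShift (F.sitesPerDir_eq (m := F.m) (K := K) (j := K - n) (m' := F.m) (K' := n) (j' := 0) (by omega)) V) c‖ ≤ C₀ * w K (K - n) j Y (fieldShift (F.sitesPerDir_eq (m := F.m) (K := K) (j := K - n) (m' := F.m) (K' := n) (j' := 0) (by omega)) V) c) :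
    CfgRefOwnΦ D B BR dist b₀ p₀ a (C₀ / (1 - q)) := by
  intro K n hnK j hj V hV Y hY
  set W := fieldShift (F.sitesPerDir_eq (m := F.m) (K := K) (j := K - n) (m' := F.m) (K' := n) (j' := 0) (by omega)) V with hW
  set x : PBond (F.P K) j → 𝕍 := B K (K - n) j Y W with hx
  set y : PBond (F.P K) j → 𝕍 := BR K (K - n) j Y W with hy
  have hwY := hw K n hnK j hj V hV Y hY
  have key := norm_sub_le_weighted_of_isFixedPt (fun c => w K (K - n) j Y W c) (fun c => (hwY c).1) (T K (K - n) j Y W) hq1 x y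
    (hfix K n hnK j hj V hV Y hY)
    (fun M hM hxy => hlip K n hnK j hj V hV Y hY x y (hB K n hnK j hj V hV Y hY) (hBR K n hnK j hj V hV Y hY) M hM hxy)
    (hdef K n hnK j hj V hV Y hY)
  have hc : 0 ≤ C₀ / (1 - q) := div_nonneg hC₀ (by linarith)
  intro c
  calc ‖x c - y c‖ ≤ C₀ / (1 - q) * w K (K - n) j Y W c := key c
    _ ≤ C₀ / (1 - q) * ((1 + dist K j Y c) * θBal F.L γ b₀ p₀ n * (((F.L : ℝ) ^ (K - n - 1 - j))⁻¹) ^ 2 * (((F.L : ℝ) ^ (1 + j))⁻¹) ^ a) :=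
        mul_le_mul_of_nonneg_left (hwY c).2 hc
    _ = C₀ / (1 - q) * (1 + dist K j Y c) * θBal F.L γ b₀ p₀ n * (((F.L : ℝ) ^ (K - n - 1 - j))⁻¹) ^ 2 * (((F.L : ℝ) ^ (1 + j))⁻¹) ^ a := by ring

end FreeWeight

/-! ## §1 The χ-instances at the canonical polymerisation and a free profile `p₁` -/

section Canon

variable {F : T3Family} {𝔠 : AlphaConsts F.L (suGroupModel 2).N} {γ : ℝ} {hγ : 0 < γ} {hγ1 : γ ≤ (min 𝔠.gamma0 1) ^ 2}

/-- **`CfgRefΦ` AT THE χ-RECORD'S CANONICAL DATUM AND ANY PROFILE `p₁`, FOR A FIXED-POINT BACKGROUND** (the door display reads (R4)/(R5) at `(𝔠.b₀, p₁)`; geometry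
`locMatched_canonCore`, `canonLegDist_matched/_nonneg`; window letters from the record) — no hypothesis left but (F), (C), (S), (D).
[cite: King1986, Prop. 3.9 (3.71)-(3.74) p.665; Balaban1987RG1, (0.1) p.251] -/
theorem cfgRefΦ_chi_of_isFixedPt (p : ∀ K, AlphaInputsT3AC.PkgAtV3Chi F 𝔠 γ hγ hγ1 K) {B BR : CfgFam ↥(lieC (suGroupModel 2)) F} {p₁ a C_s q C₀ : ℝ}
    (T : (K k b : ℕ) → Set (Site (F.P K) 0) → GaugeField (F.P K) k (Matrix.specialUnitaryGroup (Fin 2) ℂ) →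
      (PBond (F.P K) b → ↥(lieC (suGroupModel 2))) → (PBond (F.P K) b → ↥(lieC (suGroupModel 2))))
    (hq1 : q < 1) (hC₀ : 0 ≤ C₀) (ha : 0 ≤ a)
    (hB : CfgDistOwnΦ (AlphaInputsT3AC.dataOfV3chi p (canonPolymerCore fun K => (p K).toCore)) B (canonLegDist F) 𝔠.b₀ p₁ C_s)
    (hBR : CfgDistOwnΦ (AlphaInputsT3AC.dataOfV3chi p (canonPolymerCore fun K => (p K).toCore)) BR (canonLegDist F) 𝔠.b₀ p₁ C_s)
    (hfix : ∀ (K n : ℕ) (h : n ≤ K), ∀ j : ℕ, j < K - n →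
      ∀ V : GaugeField (F.P n) 0 (Matrix.specialUnitaryGroup (Fin 2) ℂ), PlaqSmall (θBal F.L γ 𝔠.b₀ p₁ n) V →
        ∀ Y ∈ (AlphaInputsT3AC.dataOfV3chi p (canonPolymerCore fun K => (p K).toCore)).Loc K (K - n)
            ((AlphaInputsT3AC.dataOfV3chi p (canonPolymerCore fun K => (p K).toCore)).triv K (K - n)) (1 + j),
          T K (K - n) j Y (fieldShift (F.sitesPerDir_eq (m := F.m) (K := K) (j := K - n) (m' := F.m) (K' := n) (j' := 0) (by omega)) V)
              (B K (K - n) j Y (fieldShift (F.sitesPerDir_eq (m := F.m) (K := K) (j := K - n) (m' := F.m) (K' := n) (j' := 0) (by omega)) V)) =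
            B K (K - n) j Y (fieldShift (F.sitesPerDir_eq (m := F.m) (K := K) (j := K - n) (m' := F.m) (K' := n) (j' := 0) (by omega)) V))
    (hlip : ∀ (K n : ℕ) (h : n ≤ K), ∀ j : ℕ, j < K - n →
      ∀ V : GaugeField (F.P n) 0 (Matrix.specialUnitaryGroup (Fin 2) ℂ), PlaqSmall (θBal F.L γ 𝔠.b₀ p₁ n) V →
        ∀ Y ∈ (AlphaInputsT3AC.dataOfV3chi p (canonPolymerCore fun K => (p K).toCore)).Loc K (K - n)
            ((AlphaInputsT3AC.dataOfV3chi p (canonPolymerCore fun K => (p K).toCore)).triv K (K - n)) (1 + j),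
          ∀ x y : PBond (F.P K) j → ↥(lieC (suGroupModel 2)),
          (∀ c, ‖x c‖ ≤ C_s * (1 + canonLegDist F K j Y c) * θBal F.L γ 𝔠.b₀ p₁ n * (((F.L : ℝ) ^ (K - n - 1 - j))⁻¹) ^ 2) →
          (∀ c, ‖y c‖ ≤ C_s * (1 + canonLegDist F K j Y c) * θBal F.L γ 𝔠.b₀ p₁ n * (((F.L : ℝ) ^ (K - n - 1 - j))⁻¹) ^ 2) →
            ∀ M : ℝ, 0 ≤ M → (∀ c, ‖x c - y c‖ ≤ M * (1 + canonLegDist F K j Y c)) →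
              ∀ c, ‖T K (K - n) j Y (fieldShift (F.sitesPerDir_eq (m := F.m) (K := K) (j := K - n) (m' := F.m) (K' := n) (j' := 0) (by omega)) V) x c -
                  T K (K - n) j Y (fieldShift (F.sitesPerDir_eq (m := F.m) (K := K) (j := K - n) (m' := F.m) (K' := n) (j' := 0) (by omega)) V) y c‖ ≤
                q * M * (1 + canonLegDist F K j Y c))
    (hdef : ∀ (K n : ℕ) (h : n ≤ K), ∀ j : ℕ, j < K - n →
      ∀ V : GaugeField (F.P n) 0 (Matrix.specialUnitaryGroup (Fin 2) ℂ), PlaqSmall (θBal F.L γ 𝔠.b₀ p₁ n) V →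
        ∀ Y ∈ (AlphaInputsT3AC.dataOfV3chi p (canonPolymerCore fun K => (p K).toCore)).Loc K (K - n)
            ((AlphaInputsT3AC.dataOfV3chi p (canonPolymerCore fun K => (p K).toCore)).triv K (K - n)) (1 + j), ∀ c : PBond (F.P K) j,
          ‖T K (K - n) j Y (fieldShift (F.sitesPerDir_eq (m := F.m) (K := K) (j := K - n) (m' := F.m) (K' := n) (j' := 0) (by omega)) V)
                (BR K (K - n) j Y (fieldShift (F.sitesPerDir_eq (m := F.m) (K := K) (j := K - n) (m' := F.m) (K' := n) (j' := 0) (by omega)) V)) c -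
              BR K (K - n) j Y (fieldShift (F.sitesPerDir_eq (m := F.m) (K := K) (j := K - n) (m' := F.m) (K' := n) (j' := 0) (by omega)) V) c‖ ≤
            C₀ * (1 + canonLegDist F K j Y c) * θBal F.L γ 𝔠.b₀ p₁ n * (((F.L : ℝ) ^ (K - n - 1 - j))⁻¹) ^ 2 * (((F.L : ℝ) ^ (1 + j))⁻¹) ^ a) :
    CfgRefΦ (AlphaInputsT3AC.dataOfV3chi p (canonPolymerCore fun K => (p K).toCore)) B BR (canonLegDist F) 𝔠.b₀ p₁ a (C₀ / (1 - q)) :=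
  cfgRefΦ_of_isFixedPt T (locMatched_canonCore fun K => (p K).toCore) (canonLegDist_matched F) (canonLegDist_nonneg F) F.hL.2.le hγ
    (hγ1.trans (sq_min_one_le _ 𝔠.gamma0_pos)) 𝔠.b₀_pos hq1 hC₀ ha hB hBR hfix hlip hdef

/-- **THE I-11 ROW `CfgDistCauchyΦ` AT THE χ-RECORD'S CANONICAL DATUM AND ANY PROFILE `p₁`, FOR A FIXED-POINT BACKGROUND WITH A COHERENT REFERENCE** (constant
`2·C₀/(1−q)`; `cfgDistCauchyΦ_of_ref ∘ cfgRefΦ_chi_of_isFixedPt`). [cite: King1986, Prop. 3.9 (3.71)-(3.74) p.665, Prop. 3.10 (3.91) p.669; Balaban1985UV3, (44) p.267] -/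
theorem cfgDistCauchyΦ_chi_of_isFixedPt (p : ∀ K, AlphaInputsT3AC.PkgAtV3Chi F 𝔠 γ hγ hγ1 K) {B BR : CfgFam ↥(lieC (suGroupModel 2)) F} {p₁ a C_s q C₀ : ℝ}
    (T : (K k b : ℕ) → Set (Site (F.P K) 0) → GaugeField (F.P K) k (Matrix.specialUnitaryGroup (Fin 2) ℂ) →
      (PBond (F.P K) b → ↥(lieC (suGroupModel 2))) → (PBond (F.P K) b → ↥(lieC (suGroupModel 2))))
    (hcoh : RefCfgCoherent BR) (hq1 : q < 1) (hC₀ : 0 ≤ C₀) (ha : 0 ≤ a)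
    (hB : CfgDistOwnΦ (AlphaInputsT3AC.dataOfV3chi p (canonPolymerCore fun K => (p K).toCore)) B (canonLegDist F) 𝔠.b₀ p₁ C_s)
    (hBR : CfgDistOwnΦ (AlphaInputsT3AC.dataOfV3chi p (canonPolymerCore fun K => (p K).toCore)) BR (canonLegDist F) 𝔠.b₀ p₁ C_s)
    (hfix : ∀ (K n : ℕ) (h : n ≤ K), ∀ j : ℕ, j < K - n →
      ∀ V : GaugeField (F.P n) 0 (Matrix.specialUnitaryGroup (Fin 2) ℂ), PlaqSmall (θBal F.L γ 𝔠.b₀ p₁ n) V →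
        ∀ Y ∈ (AlphaInputsT3AC.dataOfV3chi p (canonPolymerCore fun K => (p K).toCore)).Loc K (K - n)
            ((AlphaInputsT3AC.dataOfV3chi p (canonPolymerCore fun K => (p K).toCore)).triv K (K - n)) (1 + j),
          T K (K - n) j Y (fieldShift (F.sitesPerDir_eq (m := F.m) (K := K) (j := K - n) (m' := F.m) (K' := n) (j' := 0) (by omega)) V)
              (B K (K - n) j Y (fieldShift (F.sitesPerDir_eq (m := F.m) (K := K) (j := K - n) (m' := F.m) (K' := n) (j' := 0) (by omega)) V)) =
            B K (K - n) j Y (fieldShift (F.sitesPerDir_eq (m := F.m) (K := K) (j := K - n) (m' := F.m) (K' := n) (j' := 0) (by omega)) V))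
    (hlip : ∀ (K n : ℕ) (h : n ≤ K), ∀ j : ℕ, j < K - n →
      ∀ V : GaugeField (F.P n) 0 (Matrix.specialUnitaryGroup (Fin 2) ℂ), PlaqSmall (θBal F.L γ 𝔠.b₀ p₁ n) V →
        ∀ Y ∈ (AlphaInputsT3AC.dataOfV3chi p (canonPolymerCore fun K => (p K).toCore)).Loc K (K - n)
            ((AlphaInputsT3AC.dataOfV3chi p (canonPolymerCore fun K => (p K).toCore)).triv K (K - n)) (1 + j),
          ∀ x y : PBond (F.P K) j → ↥(lieC (suGroupModel 2)),
          (∀ c, ‖x c‖ ≤ C_s * (1 + canonLegDist F K j Y c) * θBal F.L γ 𝔠.b₀ p₁ n * (((F.L : ℝ) ^ (K - n - 1 - j))⁻¹) ^ 2) →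
          (∀ c, ‖y c‖ ≤ C_s * (1 + canonLegDist F K j Y c) * θBal F.L γ 𝔠.b₀ p₁ n * (((F.L : ℝ) ^ (K - n - 1 - j))⁻¹) ^ 2) →
            ∀ M : ℝ, 0 ≤ M → (∀ c, ‖x c - y c‖ ≤ M * (1 + canonLegDist F K j Y c)) →
              ∀ c, ‖T K (K - n) j Y (fieldShift (F.sitesPerDir_eq (m := F.m) (K := K) (j := K - n) (m' := F.m) (K' := n) (j' := 0) (by omega)) V) x c -
                  T K (K - n) j Y (fieldShift (F.sitesPerDir_eq (m := F.m) (K := K) (j := K - n) (m' := F.m) (K' := n) (j' := 0) (by omega)) V) y c‖ ≤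
                q * M * (1 + canonLegDist F K j Y c))
    (hdef : ∀ (K n : ℕ) (h : n ≤ K), ∀ j : ℕ, j < K - n →
      ∀ V : GaugeField (F.P n) 0 (Matrix.specialUnitaryGroup (Fin 2) ℂ), PlaqSmall (θBal F.L γ 𝔠.b₀ p₁ n) V →
        ∀ Y ∈ (AlphaInputsT3AC.dataOfV3chi p (canonPolymerCore fun K => (p K).toCore)).Loc K (K - n)
            ((AlphaInputsT3AC.dataOfV3chi p (canonPolymerCore fun K => (p K).toCore)).triv K (K - n)) (1 + j), ∀ c : PBond (F.P K) j,
          ‖T K (K - n) j Y (fieldShift (F.sitesPerDir_eq (m := F.m) (K := K) (j := K - n) (m' := F.m) (K' := n) (j' := 0) (by omega)) V)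
                (BR K (K - n) j Y (fieldShift (F.sitesPerDir_eq (m := F.m) (K := K) (j := K - n) (m' := F.m) (K' := n) (j' := 0) (by omega)) V)) c -
              BR K (K - n) j Y (fieldShift (F.sitesPerDir_eq (m := F.m) (K := K) (j := K - n) (m' := F.m) (K' := n) (j' := 0) (by omega)) V) c‖ ≤
            C₀ * (1 + canonLegDist F K j Y c) * θBal F.L γ 𝔠.b₀ p₁ n * (((F.L : ℝ) ^ (K - n - 1 - j))⁻¹) ^ 2 * (((F.L : ℝ) ^ (1 + j))⁻¹) ^ a) :
    CfgDistCauchyΦ (AlphaInputsT3AC.dataOfV3chi p (canonPolymerCore fun K => (p K).toCore)) B (canonLegDist F) 𝔠.b₀ p₁ a (2 * (C₀ / (1 - q))) :=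
  cfgDistCauchyΦ_of_ref hcoh (cfgRefΦ_chi_of_isFixedPt p T hq1 hC₀ ha hB hBR hfix hlip hdef)

end Canon

/-! ## §2 The door display with (R5) replaced by the fixed-point displays -/

section Display

/-- **THE SIX-ROW DOOR DISPLAY FROM THE FIXED-POINT DISPLAY** (free weight): `K1aLegRowsDisplayChiAt L 𝔠 a₀ a₁ a p₁` (rows (R1) (R2′) (N) (M1) (R4) (R5) at `(𝔠.b₀, p₁)`)
follows, with `C_B := C₀/(1−q)`, from the SAME display in which (R5) `CfgRefOwnΦ … B BR … a C_B` is REPLACED by: (S′) the (44) row for the reference `CfgDistOwnΦ … BR … C_s`,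
and — for some family of maps `T` (run `K`'s equation for its loop variables) and some positive weight family `w` dominated by the (R5) budget shape, both quantified AFTER the
package — (W) `0 < w ≤ (1+d)θ(n)x²(L^{−(1+j)})^a`, (F) `T (B) = B` on the window / listed domains, (C_w) `T` legwise `w`-weighted `q`-Lipschitz on the (44)-ball,
(D_w) `‖T (BR) c − BR c‖ ≤ C₀·w c` — constants `q < 1`, `0 ≤ C₀` with the others.  (`cfgRefOwnΦ_of_isFixedPt_weight`; every other row passes through.)  Composed with the doors of
record (`globalSupRateTSlack_of_k1aLegRowsDisplayChiAt`, `regPrIntL_of_T8_recChi_k1aLegRowsDisplayChiAt_allL`, `YM3OfFiveInputsProfile.ym3TorusSU2_of_fiveInputs_displayAt`)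
BY NAME. [cite: King1986, Prop. 3.9 (3.71)-(3.74) p.665; Balaban1985UV3, (43)-(45) pp.266-267; Balaban1985Variational, Thm 1 (8) p.279] -/
theorem k1aLegRowsDisplayChiAt_of_fixedPointDisplay {L : ℕ} {𝔠 : AlphaConsts L (suGroupModel 2).N} {a₀ a₁ a p₁ : ℝ}
    (h : ∃ (κ' ρ C C_A C_s q C₀ γB : ℝ), 0 < κ' ∧ 0 < ρ ∧ 0 ≤ C ∧ 0 ≤ C_A ∧ 0 ≤ C_s ∧ q < 1 ∧ 0 ≤ C₀ ∧ 0 < γB ∧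
      ∀ (F : T3Family) (γ : ℝ) (hF : F.L = L) (hγ : 0 < γ), γ ≤ γB → ∀ (hγ1 : γ ≤ (min (hF ▸ 𝔠).gamma0 1) ^ 2),
        ∃ (Ψ : ChartFam ↥(lieC (suGroupModel 2)) F) (BR : CfgFam ↥(lieC (suGroupModel 2)) F), KerHeightFree Ψ ∧ RefCfgCoherent BR ∧
          (AlphaInputsT3AC.OfV3ChiAt F (hF ▸ 𝔠) a₀ a₁ →
            ∃ (p : ∀ K, AlphaInputsT3AC.PkgAtV3Chi F (hF ▸ 𝔠) γ hγ hγ1 K), (∀ K, (p K).a₀ = a₀ ∧ (p K).a₁ = a₁) ∧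
              ∃ (Φ : ChartFam ↥(lieC (suGroupModel 2)) F) (e : VacFam F) (B : CfgFam ↥(lieC (suGroupModel 2)) F)
                (T : (K k b : ℕ) → Set (Site (F.P K) 0) → GaugeField (F.P K) k (Matrix.specialUnitaryGroup (Fin 2) ℂ) →
                  (PBond (F.P K) b → ↥(lieC (suGroupModel 2))) → (PBond (F.P K) b → ↥(lieC (suGroupModel 2))))
                (w : (K k b : ℕ) → Set (Site (F.P K) 0) → GaugeField (F.P K) k (Matrix.specialUnitaryGroup (Fin 2) ℂ) → PBond (F.P K) b → ℝ),
                KernelRefOwnΦ (AlphaInputsT3AC.dataOfV3chi p (canonPolymerCore fun K => (p K).toCore)) Φ Ψ (canonLegDist F) κ' (hF ▸ 𝔠).κ a C ∧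
                ChartAnalyticΦ (AlphaInputsT3AC.dataOfV3chi p (canonPolymerCore fun K => (p K).toCore)) (rescaleΦw (canonLegDist F) κ' Φ) (hF ▸ 𝔠).κ ρ C_A ∧
                NewLevelIsBirth (fun K => (p K).toCore) Φ e B ∧
                OldTermsAreJetsOwn (fun K => (p K).toCore) Φ e B ∧
                CfgDistOwnΦ (AlphaInputsT3AC.dataOfV3chi p (canonPolymerCore fun K => (p K).toCore)) B (canonLegDist F) (hF ▸ 𝔠).b₀ p₁ C_s ∧
                CfgDistOwnΦ (AlphaInputsT3AC.dataOfV3chi p (canonPolymerCore fun K => (p K).toCore)) BR (canonLegDist F) (hF ▸ 𝔠).b₀ p₁ C_s ∧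
                (∀ (K n : ℕ) (h : n ≤ K), ∀ j : ℕ, j < K - n →
                  ∀ V : GaugeField (F.P n) 0 (Matrix.specialUnitaryGroup (Fin 2) ℂ), PlaqSmall (θBal F.L γ (hF ▸ 𝔠).b₀ p₁ n) V →
                    ∀ Y ∈ (AlphaInputsT3AC.dataOfV3chi p (canonPolymerCore fun K => (p K).toCore)).Loc K (K - n) ((AlphaInputsT3AC.dataOfV3chi p (canonPolymerCore fun K => (p K).toCore)).triv K (K - n)) (1 + j), ∀ c : PBond (F.P K) j,
                      0 < w K (K - n) j Y (fieldShift (F.sitesPerDir_eq (m := F.m) (K := K) (j := K - n) (m' := F.m) (K' := n) (j' := 0) (by omega)) V) c ∧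
                      w K (K - n) j Y (fieldShift (F.sitesPerDir_eq (m := F.m) (K := K) (j := K - n) (m' := F.m) (K' := n) (j' := 0) (by omega)) V) c ≤ (1 + canonLegDist F K j Y c) * θBal F.L γ (hF ▸ 𝔠).b₀ p₁ n * (((F.L : ℝ) ^ (K - n - 1 - j))⁻¹) ^ 2 *
                        (((F.L : ℝ) ^ (1 + j))⁻¹) ^ a) ∧
                (∀ (K n : ℕ) (h : n ≤ K), ∀ j : ℕ, j < K - n →
                  ∀ V : GaugeField (F.P n) 0 (Matrix.specialUnitaryGroup (Fin 2) ℂ), PlaqSmall (θBal F.L γ (hF ▸ 𝔠).b₀ p₁ n) V →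
                    ∀ Y ∈ (AlphaInputsT3AC.dataOfV3chi p (canonPolymerCore fun K => (p K).toCore)).Loc K (K - n) ((AlphaInputsT3AC.dataOfV3chi p (canonPolymerCore fun K => (p K).toCore)).triv K (K - n)) (1 + j),
                      T K (K - n) j Y (fieldShift (F.sitesPerDir_eq (m := F.m) (K := K) (j := K - n) (m' := F.m) (K' := n) (j' := 0) (by omega)) V) (B K (K - n) j Y (fieldShift (F.sitesPerDir_eq (m := F.m) (K := K) (j := K - n) (m' := F.m) (K' := n) (j' := 0) (by omega)) V)) = B K (K - n) j Y (fieldShift (F.sitesPerDir_eq (m := F.m) (K := K) (j := K - n) (m' := F.m) (K' := n) (j' := 0) (by omega)) V)) ∧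
                (∀ (K n : ℕ) (h : n ≤ K), ∀ j : ℕ, j < K - n →
                  ∀ V : GaugeField (F.P n) 0 (Matrix.specialUnitaryGroup (Fin 2) ℂ), PlaqSmall (θBal F.L γ (hF ▸ 𝔠).b₀ p₁ n) V →
                    ∀ Y ∈ (AlphaInputsT3AC.dataOfV3chi p (canonPolymerCore fun K => (p K).toCore)).Loc K (K - n) ((AlphaInputsT3AC.dataOfV3chi p (canonPolymerCore fun K => (p K).toCore)).triv K (K - n)) (1 + j), ∀ x y : PBond (F.P K) j → ↥(lieC (suGroupModel 2)),
                      (∀ c, ‖x c‖ ≤ C_s * (1 + canonLegDist F K j Y c) * θBal F.L γ (hF ▸ 𝔠).b₀ p₁ n * (((F.L : ℝ) ^ (K - n - 1 - j))⁻¹) ^ 2) →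
                      (∀ c, ‖y c‖ ≤ C_s * (1 + canonLegDist F K j Y c) * θBal F.L γ (hF ▸ 𝔠).b₀ p₁ n * (((F.L : ℝ) ^ (K - n - 1 - j))⁻¹) ^ 2) →
                        ∀ M : ℝ, 0 ≤ M → (∀ c, ‖x c - y c‖ ≤ M * w K (K - n) j Y (fieldShift (F.sitesPerDir_eq (m := F.m) (K := K) (j := K - n) (m' := F.m) (K' := n) (j' := 0) (by omega)) V) c) →
                          ∀ c, ‖T K (K - n) j Y (fieldShift (F.sitesPerDir_eq (m := F.m) (K := K) (j := K - n) (m' := F.m) (K' := n) (j' := 0) (by omega)) V) x c - T K (K - n) j Y (fieldShift (F.sitesPerDir_eq (m := F.m) (K := K) (j := K - n) (m' := F.m) (K' := n) (j' := 0) (by omega)) V) y c‖ ≤ q * M * w K (K - n) j Y (fieldShift (F.sitesPerDir_eq (m := F.m) (K := K) (j := K - n) (m' := F.m) (K' := n) (j' := 0) (by omega)) V) c) ∧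
                (∀ (K n : ℕ) (h : n ≤ K), ∀ j : ℕ, j < K - n →
                  ∀ V : GaugeField (F.P n) 0 (Matrix.specialUnitaryGroup (Fin 2) ℂ), PlaqSmall (θBal F.L γ (hF ▸ 𝔠).b₀ p₁ n) V →
                    ∀ Y ∈ (AlphaInputsT3AC.dataOfV3chi p (canonPolymerCore fun K => (p K).toCore)).Loc K (K - n) ((AlphaInputsT3AC.dataOfV3chi p (canonPolymerCore fun K => (p K).toCore)).triv K (K - n)) (1 + j), ∀ c : PBond (F.P K) j,
                      ‖T K (K - n) j Y (fieldShift (F.sitesPerDir_eq (m := F.m) (K := K) (j := K - n) (m' := F.m) (K' := n) (j' := 0) (by omega)) V) (BR K (K - n) j Y (fieldShift (F.sitesPerDir_eq (m := F.m) (K := K) (j := K - n) (m' := F.m) (K' := n) (j' := 0) (by omega)) V)) c - BR K (K - n) j Y (fieldShift (F.sitesPerDir_eq (m := F.m) (K := K) (j := K - n) (m' := F.m) (K' := n) (j' := 0) (by omega)) V) c‖ ≤ C₀ * w K (K - n) j Y (fieldShift (F.sitesPerDir_eq (m := F.m) (K := K) (j := K - n) (m' := F.m) (K' := n) (j' :=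 0) (by omega)) V) c))) :
    K1aLegRowsDisplayChiAt L 𝔠 a₀ a₁ a p₁ := by
  obtain ⟨κ', ρ, C, C_A, C_s, q, C₀, γB, hκ', hρ, hC, hCA, hCs, hq1, hC₀, hγB, hall⟩ := h
  refine ⟨κ', ρ, C, C_A, C_s, C₀ / (1 - q), γB, hκ', hρ, hC, hCA, hCs, div_nonneg hC₀ (by linarith), hγB, fun F γ hF hγ hγle hγ1 => ?_⟩
  obtain ⟨Ψ, BR, hΨ, hBR, himp⟩ := hall F γ hF hγ hγle hγ1
  refine ⟨Ψ, BR, hΨ, hBR, fun hOf => ?_⟩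
  obtain ⟨p, hp, Φ, e, B, T, w, hK, hA, hN, hM1, hS, hSR, hw, hfix, hlip, hdef⟩ := himp hOf
  exact ⟨p, hp, Φ, e, B, hK, hA, hN, hM1, hS, cfgRefOwnΦ_of_isFixedPt_weight T w hq1 hC₀ hS hSR hw hfix hlip hdef⟩

end Display

end Summit.QuantumFields.YangMills.Theorems.GlobalSlackKernelLeg

end
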